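import Mathlib.GroupTheory.Index
import Mathlib.GroupTheory.QuotientGroup.Basic
import Mathlib.Algebra.Group.Conj
import Literature.GroupTheory.CombinatorialGroupTheory.FreeGroupConjugacySeparable
import Literature.GroupTheory.CombinatorialGroupTheory.SurfaceGroupConjugacySeparable
import HarnessLib

/-!
# Conjugacy separability (Mostowski, Stebe); orientable surface groups are conjugacy separable
# (Stebe 1972, Thm. 3.3) — the predicate, its reformulations, and the NAMED FACT

Topic `Literature/GroupTheory/CombinatorialGroupTheory`.  P. F. Stebe, *Conjugacy separability of
certain Fuchsian groups*, Trans. Amer. Math. Soc. 163 (1972) 173–188 [Stebe1972], p. 173: "Let `G`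
be a group. An element `g` is c.d. in `G` if and only if given any element `h` of `G`, either it is
conjugate to `h` or there is a homomorphism `ξ` from `G` onto a finite group such that `ξ(g)` is not
conjugate to `ξ(h)`. Following A. Mostowski, a group is conjugacy separable or c.s. if and only if
every element of the group is c.d."; and Theorem 3.3, p. 182: "The groups
`Gₙ = ⟨a₁, …, aₙ, b₁, …, bₙ ; (a₁, b₁) ⋯ (aₙ, bₙ) = 1⟩ are c.s." (proved there for `n = 2, 3` and by
induction for `n ≥ 4`).

Contents:
* `IsConjugacySeparable G` — the DEFINITION (Stebe's form: a homomorphism onto a finite group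
  separating the conjugacy classes), for a group `G : Type u` with finite targets in `Type u`;
* `isConjugacySeparable_iff_quotient` — PROVED equivalence with the finite-quotient form
  "`∃ K ⊴ G` of finite index with the images in `G ⧸ K` not conjugate" (the binder shape
  `∃ (K) (_ : K.Normal) (_ : K.FiniteIndex), ¬ IsConj (mk u) (mk v)` in which the tree's
  `FreeGroup.conjugacySeparable` and the [IUTchI] Thm. 2.6 companions carry conjugacy separability);
* `IsConjugacySeparable.of_mulEquiv` — transport along a group isomorphism;
* `isConjugacySeparable_freeGroup` — free groups (any rank) are c.s.: the tree's theorem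
  `FreeGroup.exists_hom_finite_not_isConj` (Stebe 1970 / Lyndon–Schupp I Prop. 4.8, file
  `FreeGroupConjugacySeparable.lean`), repackaged — no new content;
* `isConjugacySeparable_surfaceGroup_of_fact`, `surfaceGroupConjugacySeparable_iff` — the link
  with the tree's NAMED FACT `SurfaceGroupConjugacySeparable` ([Stb2] = Stebe 1972, Thm. 3.3: for
  `n ≥ 2` the orientable surface group `Sₙ` is conjugacy separable; file
  `SurfaceGroupConjugacySeparable.lean`, abc-iut-L5-d2, the single home of that fact): given the fact,
  `IsConjugacySeparable (SurfaceGroup n)`; and the fact is equivalent to that statement for all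
  `n ≥ 2`.  (Revision note: the first revision of this file typed the fact a second time as
  `surfaceGroup_isConjugacySeparable`; removed per the layer lead's de-duplication ruling — ONE
  spelling per notion.)  The fact is the external input "[Stb2], Theorem 3.3" of Mochizuki, IUTchI,
  proof of Thm. 2.6 (p. 57), alongside "[Stb1], Theorem 1, when `G` is free"
  (= `isConjugacySeparable_freeGroup`, PROVED in the tree).

Deliberately NOT here: conjugacy distinguishedness of infinite-order elements of general Fuchsian
groups (Stebe's Thm. 3.10), `p`-conjugacy separability, subgroup separability (M. Hall / LERF).
-/

namespace Literature.GroupTheory.CombinatorialGroupTheory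

universe u v

/-- **Conjugacy separability** (A. Mostowski; P. F. Stebe, Trans. AMS 163 (1972), p. 173): a group
`G` is *conjugacy separable* if for any two non-conjugate elements `g, h ∈ G` there is a
homomorphism `ξ` from `G` onto a finite group such that `ξ(g)` is not conjugate to `ξ(h)` ("`g` is
c.d. in `G`" for every `g`).  The finite targets are taken in the universe of `G` (no loss: one may
always take `G ⧸ K`, see `isConjugacySeparable_iff_quotient`). [cite: Stebe1972, §1 p.173] -/
def IsConjugacySeparable (G : Type u) [Group G] : Prop :=
  ∀ g h : G, ¬ IsConj g h →
    ∃ (Q : Type u) (_ : Group Q) (_ : Finite Q) (ξ : G →* Q),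
      Function.Surjective ξ ∧ ¬ IsConj (ξ g) (ξ h)

variable {G : Type u} [Group G]

/-- Conjugacy separability in FINITE-QUOTIENT form: non-conjugate `g, h` stay non-conjugate in
`G ⧸ K` for some normal subgroup `K` of finite index.  Equivalent to Stebe's definition (take
`K = Ker ξ`, resp. `ξ = G → G ⧸ K`). [cite: Stebe1972, §1 p.173] -/
theorem isConjugacySeparable_iff_quotient :
    IsConjugacySeparable G ↔
      ∀ g h : G, ¬ IsConj g h →
        ∃ (K : Subgroup G) (_ : K.Normal) (_ : K.FiniteIndex),
          ¬ IsConj (QuotientGroup.mk g : G ⧸ K) (QuotientGroup.mk h) := by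
  constructor
  · intro hG g h hgh
    obtain ⟨Q, _, _, ξ, hξ, hnc⟩ := hG g h hgh
    haveI : ξ.ker.FiniteIndex := inferInstance
    refine ⟨ξ.ker, inferInstance, inferInstance, fun hc => hnc ?_⟩
    -- transport conjugacy along `G ⧸ Ker ξ ≃* range ξ ⊆ Q`
    obtain ⟨c, hc⟩ := isConj_iff.mp hc
    obtain ⟨x, rfl⟩ := QuotientGroup.mk_surjective c
    have hx : (QuotientGroup.mk (x * g * x⁻¹) : G ⧸ ξ.ker) = QuotientGroup.mk h := by
      simpa only [QuotientGroup.mk_mul, QuotientGroup.mk_inv] using hc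
    rw [QuotientGroup.eq] at hx
    have h1 : ξ ((x * g * x⁻¹)⁻¹ * h) = 1 := hx
    rw [map_mul, map_inv, inv_mul_eq_one] at h1
    refine isConj_iff.mpr ⟨ξ x, ?_⟩
    rw [← map_mul, ← map_inv, ← map_mul, h1]
  · intro hG g h hgh
    obtain ⟨K, hKn, hKf, hnc⟩ := hG g h hgh
    exact ⟨G ⧸ K, inferInstance, Subgroup.finite_quotient_of_finiteIndex, QuotientGroup.mk' K,
      QuotientGroup.mk'_surjective K, hnc⟩

/-- Conjugacy separability, contrapositive reading of the finite-quotient form: elements conjugate in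
every finite quotient `G ⧸ K` are conjugate in `G`. [cite: Stebe1972, §1 p.173] -/
theorem IsConjugacySeparable.isConj_of_forall_quotient (hG : IsConjugacySeparable G) {g h : G}
    (hq : ∀ (K : Subgroup G) [K.Normal] [K.FiniteIndex],
      IsConj (QuotientGroup.mk g : G ⧸ K) (QuotientGroup.mk h)) :
    IsConj g h := by
  by_contra hgh
  obtain ⟨K, hKn, hKf, hnc⟩ := isConjugacySeparable_iff_quotient.mp hG g h hgh
  exact hnc (hq K)

/-- Conjugacy separability is invariant under group isomorphism. [cite: Stebe1972, §1 p.173] -/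
theorem IsConjugacySeparable.of_mulEquiv {H : Type u} [Group H] (e : G ≃* H)
    (hH : IsConjugacySeparable H) : IsConjugacySeparable G := by
  intro g h hgh
  have hgh' : ¬ IsConj (e g) (e h) := fun hc =>
    hgh (by simpa using e.symm.toMonoidHom.map_isConj hc)
  obtain ⟨Q, _, _, ξ, hξ, hnc⟩ := hH (e g) (e h) hgh'
  exact ⟨Q, inferInstance, inferInstance, ξ.comp e.toMonoidHom,
    hξ.comp e.surjective, hnc⟩

/-- **Free groups are conjugacy separable** (Stebe 1970, Thm. 1; Baumslag–Taylor; Lyndon–Schupp I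
Prop. 4.8) — the tree's theorem `FreeGroup.exists_hom_finite_not_isConj` (abc-iut-L5-t14,
`FreeGroupConjugacySeparable.lean`) in the vocabulary of this file; this is "[Stb1], Theorem 1, when
`G` is free" of Mochizuki, IUTchI p. 57. [cite: LyndonSchupp2001, Ch. I Prop. 4.8] -/
theorem isConjugacySeparable_freeGroup (ι : Type u) : IsConjugacySeparable (FreeGroup ι) :=
  fun _ _ h => FreeGroup.exists_hom_finite_not_isConj h

/-- **Orientable surface groups are conjugacy separable (Stebe 1972, Thm. 3.3)** in the vocabulary of
this file, FROM the tree's named fact `SurfaceGroupConjugacySeparable`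
(`SurfaceGroupConjugacySeparable.lean`, abc-iut-L5-d2 — the ONE home of [Stb2] per the L5-lead's
de-duplication ruling of 2026-08-25; an earlier revision of this file carried a second copy of the
fact, now removed): GIVEN that fact, `Sₙ` is conjugacy separable for every `n ≥ 2`.  Conditional on the
fact; nothing is asserted. [cite: Stebe1972, Thm 3.3 p.182] -/
theorem isConjugacySeparable_surfaceGroup_of_fact (h : SurfaceGroupConjugacySeparable) {n : ℕ}
    (hn : 2 ≤ n) : IsConjugacySeparable (Literature.Topology.FourManifolds.SurfaceGroup n) :=
  isConjugacySeparable_iff_quotient.mpr (h n hn)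

/-- The named fact `SurfaceGroupConjugacySeparable` is EQUIVALENT to "`Sₙ` is conjugacy separable
(`IsConjugacySeparable`, Stebe's surjection form) for all `n ≥ 2`" — Stebe's Theorem 3.3 as he states it
(Trans. AMS 163 (1972), p. 182, with the definition of p. 173). [cite: Stebe1972, Thm 3.3 p.182] -/
theorem surfaceGroupConjugacySeparable_iff :
    SurfaceGroupConjugacySeparable ↔
      ∀ n : ℕ, 2 ≤ n → IsConjugacySeparable (Literature.Topology.FourManifolds.SurfaceGroup n) := by
  constructor
  · exact fun h n hn => isConjugacySeparable_surfaceGroup_of_fact h hn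
  · intro h n hn u v huv
    exact isConjugacySeparable_iff_quotient.mp (h n hn) u v huv

end Literature.GroupTheory.CombinatorialGroupTheory
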